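import Literature.NumberTheory.EllipticCurves.CyclotomicLayerTatePairing
import Literature.NumberTheory.GaloisRepresentations.CoinducedDiscreteGaloisModuleProofs
import Literature.NumberTheory.GaloisCohomology.ArchimedeanInvariantMap
import Literature.NumberTheory.GaloisRepresentations.LocalDualityDescent
import Literature.NumberTheory.GaloisRepresentations.LocalGlobalCohomologyFiniteProofs
import Literature.NumberTheory.GaloisRepresentations.ContinuousRepHomDual
import Summits.BirchSwinnertonDyer.BirchSwinnertonDyer.Theorems.ThetaPartnerAtTwoSignedKatoUpToAtTwoLayerGlobalShapiro
import HarnessLib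

/-!
# Route `ThetaPartnerAtTwo` (TP2), crux K2R0P♭ `SignedMainConjectureCMTwoRankZeroOfPubOfFlat` (item stmt-BirchSwinnertonDyer-26471) /
# K2r0P (item 24945), line `rankzero` v19, stub `stub_poitouTateDeepTwoGen` = (S_PT) — brick B3 «local Shapiro dictionary»:
# THE local Tate pairing of `Coind_{Γ_n}^{Γ_ℚ} E[N]` at `v ∣ p`, for THE canonical invariant map, IS the cyclotomic-layer pairing
# `CyclotomicLayer.layerPairingMod` of the (S_PT)/(E) currency

Width seat `bsd-wall-tp2-p2-w3` g3 (cell `bsd-wall`), for the lead's assembly interface `B9-INTERFACE-g10.md` (hypothesis (E)) and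
w2's bricks B4/B5 (design memo `PT-DEEP-HALF-DESIGN-w2g4.md` §2 (a)–(c)). THEOREMS ONLY (no definition, no named fact, no instance
declaration, no `sorry`); closes no item; BSD is NOT proved by any of this.

## Setting
`W/ℚ` elliptic, level `N ≥ 1` with Weil data `e` (as in `CyclotomicLayerTatePairing.lean`), a `ℤ_p`-extension `κ` of `ℚ`, a layer `n`
(`Γ_n = κ.layerSubgroup n`), a finite place `v`; `ρ = W.torsionGaloisModule N`, **`ρc = ρ.coind Γ_n _`** = `Maps(Γ_ℚ ⧸ Γ_n, E[N])` as a
discrete Galois module (`CoinducedDiscreteGaloisModule.lean`, p626974: `toTopRep` is the Shapiro model `coindFin` by `rfl`),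
**`Ψ = coindTateDualMor ρ ρ Γ_n (weilPairingHom …)`** `: Maps(Γ_ℚ ⧸ Γ_n, E[N]) ⟶ Maps(Γ_ℚ ⧸ Γ_n, E[N])^D` (summed Weil pairing; an
isomorphism for `e` non-degenerate), `Sh = shapiroLift ρ.toTopRep Γ_n …` the GLOBAL Shapiro lift `H¹(Γ_n, E[N]) ⥲ H¹(ℚ, ρc)`, and at `v`:
`θ = Γ_v → Γ_ℚ`, `U_n = CyclotomicLayer.layerGroup κ v n`, **`pull_v = H¹(coindFinPull) : H¹(ℚ_v, ρc) → H¹(Γ_v, Maps(Γ_v ⧸ U_n, E[N]|))`**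
(`θ̄ : Γ_v ⧸ U_n → Γ_ℚ ⧸ Γ_n` is bijective when `κ` is cyclotomic and `v ∣ p` — ONE ORBIT, K3's `quotientPull_layerGroup_bijective`).

## What is proved (all in the Literature names `CyclotomicLayer.*` of the (E) currency)
* `cohomologyMap_coindFinPull_localization_shapiroLift` — **`pull_v (loc_v (Sh a)) = layerShapiro (layerLoc a)`** (K3's
  `map_coindFinPull_shapiroLift_layer` with the localisation split off).
* `localTatePairingZMod_canonical_localization_coindTateDual_shapiroLift` — for a LOCAL class `a' ∈ H¹(ℚ_v, ρc)` and a layer class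
  `b ∈ H¹(Γ_n, E[N])`: **`⟨a', loc_v (H¹(Ψ)(Sh b))⟩_v = invAt_v (pull_v a' ∪_{layerSumPairing} layerShapiro (layerLoc b))`** for THE
  canonical invariant map (`LocalInvariants.canonical ℚ N`, = `localInvariantMap` = `CyclotomicLayer.invAt` at `v`) — the Literature
  twins `localization_cohomologyMap_coindTateDualMor` / `localTatePairing_coind_cohomologyMap_eq_cupProduct_pull` read at `ℚ`, `v ∣ p`.
* `localTatePairingZMod_canonical_localization_shapiroLift_shapiroLift` — both classes global: **`⟨loc_v (Sh a), loc_v (H¹(Ψ)(Sh b))⟩_v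
  = CyclotomicLayer.layerPairingMod W N e … κ v n a Q`** as soon as `layerLoc b = layerKummer Q` — the Poitou–Tate local term at `v ∣ p` of
  the Coind module, for THE maps of `LocalInvariants.SelmerComplement`, IS the (E)-currency pairing value.
* §3 duality: `bijective_cohomologyMap_of_bijective` (generic: a bijective morphism of discrete `TopRep`s is a bijection on `Hⁿ`),
  `bijective_weilPairingHom_flip` (`E[N] ⥲ E[N]^D` for `e` non-degenerate), `bijective_cohomologyMap_coindFinPull` (**`pull_v` bijective**
  at `v ∣ p`), `existsUnique_shapiroLift_coindTateDual_eq` (**every `y ∈ H¹(ℚ, ρc^D)` is `H¹(Ψ)(Sh b)` for a unique layer class `b`** —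
  w2's B5 reads dual Selmer classes as layer classes through it), `exists_injective_dualTransport` (**the dual transport
  `T_v : H¹(Γ_v, Maps(Γ_v ⧸ U_n, E[N]|)) ↪ H¹(ℚ_v, ρc^D)`** with `⟨a', T_v t⟩_v = invAt_v (pull_v a' ∪ t)`: the classes `c_Q = T_v (layerShapiro
  (layerKummer Q))` generate the subgroup `C` of `SelmerComplement.exists_selmer_localTatePairing_eq_of_subgroup`), and
  `eq_zero_of_forall_invAt_cupProduct_pull_eq_zero` (**non-degeneracy of the layer pairing** = local Tate duality for `ℚ_{n,v}` in the
  Shapiro model, from `LocalInvariants.canonical_isPerfect` on `ρc`).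

References: [NeukirchSchmidtWingberg2008] I §5 Prop. (1.5.3)(iv), I §6 (1.6.4)–(1.6.5); [MilneADT2006] I Cor. 2.3, Thm. 4.10, I §6
(proof of Prop. 6.9); [Kobayashi2003] (8.23) (p. 18), (7.17)–(7.21).
-/

set_option autoImplicit false
-- the Theorems namespace of this sub repeats the summit name by design (D-0017 nested layout)
set_option linter.dupNamespace false

noncomputable section

open scoped Classical

namespace Summit.BirchSwinnertonDyer.BirchSwinnertonDyer.Theorems

namespace SignedLowerOffTwo.PTDeep

open CategoryTheory Field NumberField IsDedekindDomain WeierstrassCurve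
  Literature.NumberTheory.EllipticCurves Literature.NumberTheory.EllipticCurves.CyclotomicLayer Literature.NumberTheory.EllipticCurves.Kobayashi2003
  Literature.NumberTheory.GaloisRepresentations Literature.NumberTheory.GaloisRepresentations.DiscreteGaloisModule
  Literature.NumberTheory.GaloisCohomology ZpExtension

-- Cup products need `LocallyCompactSpace Γ`; as in the K3 layer files the compactness of absolute Galois groups is a local instance only;
-- `E[N]` is finite (local instance, as in `CyclotomicLayerTatePairing.lean`).
attribute [local instance] absoluteGaloisGroup_compactSpace finite_geomTorsion_of_neZero

variable (W : WeierstrassCurve ℚ) [W.IsElliptic] (N : ℕ) [NeZero N]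
  (e : geomTorsion W N → geomTorsion W N → AlgebraicClosure ℚ)
  (hμ : ∀ S T, e S T ^ N = 1)
  (hadd₁ : ∀ S₁ S₂ T, e (S₁ + S₂) T = e S₁ T * e S₂ T)
  (hadd₂ : ∀ S T₁ T₂, e S (T₁ + T₂) = e S T₁ * e S T₂)
  (hgal : ∀ (σ : absoluteGaloisGroup ℚ) (S T : geomTorsion W N), σ • e S T = e (σ • S) (σ • T))
  {p : ℕ} [Fact p.Prime] (κ : ZpExtension ℚ p) (v : HeightOneSpectrum (𝓞 ℚ)) (hκ : κ.IsCyclotomic) (hv : (p : 𝓞 ℚ) ∈ v.asIdeal)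

/-! ## §1 `pull_v ∘ loc_v ∘ Sh = layerShapiro ∘ layerLoc` -/

omit [W.IsElliptic] [NeZero N] in
include hκ hv in
/-- **`pull_v (loc_v (Sh a)) = layerShapiro (layerLoc a)`** for `a ∈ H¹(Γ_n, E[N])`: localising the global Shapiro lift of `a` to `ℚ_v`
(`galoisCohomology.localization` of the discrete Galois module `ρc = Maps(Γ_ℚ ⧸ Γ_n, E[N])`) and pulling back along
`θ̄ : Γ_v ⧸ U_n → Γ_ℚ ⧸ Γ_n` (`coindFinPull`, identity on `E[N]`) gives the LAYER Shapiro lift of the layer localisation of `a` — K3's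
`map_coindFinPull_shapiroLift_layer` (one orbit at `v ∣ p`) with the localisation split off (`ContinuousCohomology` functoriality, read on
cocycles). [cite: NeukirchSchmidtWingberg2008, I §6 Prop. (1.6.4), (1.6.5)] -/
theorem cohomologyMap_coindFinPull_localization_shapiroLift (n : ℕ) [Fintype (absoluteGaloisGroup ℚ ⧸ κ.layerSubgroup n)]
    {s : absoluteGaloisGroup ℚ ⧸ κ.layerSubgroup n → absoluteGaloisGroup ℚ}
    (hs : ∀ y, (s y : absoluteGaloisGroup ℚ ⧸ κ.layerSubgroup n) = y)
    (hs1 : s ((1 : absoluteGaloisGroup ℚ) : absoluteGaloisGroup ℚ ⧸ κ.layerSubgroup n) = 1)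
    (a : H1 (W.torsionGaloisModule (N : ℤ)) (κ.layerSubgroup n)) :
    cohomologyMap (coindFinPull (W.torsionGaloisModule (N : ℤ)).toTopRep (κ.layerSubgroup n)
        (resGalOfEmb (closureEmb (K := ℚ) (v.adicCompletion ℚ))) (X' := torsionLocalRep W N v)
        (TopRep.ofHom ⟨ContinuousLinearMap.id ℤ (geomTorsion W N), fun _ => rfl⟩) (layerGroup κ v n) (fun _ h => h)) 1
      (galoisCohomology.localization ((W.torsionGaloisModule (N : ℤ)).coind (κ.layerSubgroup n) (κ.isOpen_layerSubgroup n))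
        (Sum.inr v) 1
        (shapiroLift (W.torsionGaloisModule (N : ℤ)).toTopRep (κ.layerSubgroup n) (κ.isOpen_layerSubgroup n) hs hs1 a)) =
      layerShapiro W N κ v n (layerLoc W N κ v n a) := by
  rw [show layerShapiro W N κ v n (layerLoc W N κ v n a) =
      SignedKatoOffTwo.LayerPairing.layerShapiro W N κ v n (SignedKatoOffTwo.LayerPairing.layerLoc W N κ v n a) from rfl,
    ← SignedKatoOffTwo.LayerPairing.map_coindFinPull_shapiroLift_layer W N κ v hκ hv n hs hs1 a]
  obtain ⟨F, hF⟩ := oneCocycleClass_surjective _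
    (shapiroLift (W.torsionGaloisModule (N : ℤ)).toTopRep (κ.layerSubgroup n) (κ.isOpen_layerSubgroup n) hs hs1 a)
  rw [← hF]
  change cohomologyMap _ 1 (ContinuousCohomology.map _ _ 1 (oneCocycleClass _ F)) = ContinuousCohomology.map _ _ 1 (oneCocycleClass _ F)
  rw [map_oneCocycleClass, cohomologyMap_oneCocycleClass, map_oneCocycleClass]
  rfl

/-! ## §2 The local Tate pairing of `ρc` at `v ∣ p` against `loc_v (H¹(Ψ)(Sh b))` is the layer cup product -/

include hκ hv in
/-- **`⟨a', loc_v (H¹(Ψ)(Sh b))⟩_v = invAt_v (pull_v a' ∪_{layerSumPairing} layerShapiro (layerLoc b))`** for THE canonical invariant maps: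
for a LOCAL class `a' ∈ H¹(ℚ_v, Maps(Γ_ℚ ⧸ Γ_n, E[N]))` and a layer class `b ∈ H¹(Γ_n, E[N])`, the local Tate pairing
(`localTatePairingZMod … (LocalInvariants.canonical ℚ N (Sum.inr v))`, the pairing of `LocalInvariants.SelmerComplement` /
`IsPerfect`) of `a'` with the localisation of the image of `Sh b` under the summed-Weil duality `Ψ` is THE invariant of the LAYER cup
product of the pulled-back class `pull_v a'` with `layerShapiro (layerLoc b)` (`CyclotomicLayer.layerSumPairing`, `CyclotomicLayer.invAt`).
Ingredients: `localization_cohomologyMap_coindTateDualMor`, `localTatePairing_coind_cohomologyMap_eq_cupProduct_pull` (one orbit at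
`v ∣ p`: K3's `quotientPull_layerGroup_bijective`) and §1. [cite: MilneADT2006, Ch. I Cor. 2.3, Ch. I §6 (proof of Prop. 6.9)]
[cite: NeukirchSchmidtWingberg2008, I §5 Prop. (1.5.3)(iv), I §6 (1.6.5)] -/
theorem localTatePairingZMod_canonical_localization_coindTateDual_shapiroLift (n : ℕ)
    [Fintype (absoluteGaloisGroup ℚ ⧸ κ.layerSubgroup n)]
    {s : absoluteGaloisGroup ℚ ⧸ κ.layerSubgroup n → absoluteGaloisGroup ℚ}
    (hs : ∀ y, (s y : absoluteGaloisGroup ℚ ⧸ κ.layerSubgroup n) = y)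
    (hs1 : s ((1 : absoluteGaloisGroup ℚ) : absoluteGaloisGroup ℚ ⧸ κ.layerSubgroup n) = 1)
    (a' : galoisCohomology
      (((W.torsionGaloisModule (N : ℤ)).coind (κ.layerSubgroup n) (κ.isOpen_layerSubgroup n)).toLocal (Sum.inr v)) 1)
    (b : H1 (W.torsionGaloisModule (N : ℤ)) (κ.layerSubgroup n)) :
    localTatePairingZMod ((W.torsionGaloisModule (N : ℤ)).coind (κ.layerSubgroup n) (κ.isOpen_layerSubgroup n)) N (Sum.inr v)
        (LocalInvariants.canonical ℚ N (Sum.inr v)) a'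
        (galoisCohomology.localization
          (((W.torsionGaloisModule (N : ℤ)).coind (κ.layerSubgroup n) (κ.isOpen_layerSubgroup n)).tateDual N) (Sum.inr v) 1
          (cohomologyMap (coindTateDualMor (W.torsionGaloisModule (N : ℤ)) (W.torsionGaloisModule (N : ℤ)) (κ.layerSubgroup n)
              (weilPairingHom W N e hμ hadd₁ hadd₂) (κ.isOpen_layerSubgroup n)
              (fun σ S T => (weilContPairing W N e hμ hadd₁ hadd₂ hgal).toLin_smul σ S T)) 1
            (shapiroLift (W.torsionGaloisModule (N : ℤ)).toTopRep (κ.layerSubgroup n) (κ.isOpen_layerSubgroup n) hs hs1 b))) =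
      invAt N v ((layerSumPairing W N e hμ hadd₁ hadd₂ hgal κ v n).cupProduct
        (cohomologyMap (coindFinPull (W.torsionGaloisModule (N : ℤ)).toTopRep (κ.layerSubgroup n)
          (resGalOfEmb (closureEmb (K := ℚ) (v.adicCompletion ℚ))) (X' := torsionLocalRep W N v)
          (TopRep.ofHom ⟨ContinuousLinearMap.id ℤ (geomTorsion W N), fun _ => rfl⟩) (layerGroup κ v n) (fun _ h => h)) 1 a')
        (layerShapiro W N κ v n (layerLoc W N κ v n b))) := by
  rw [localTatePairingZMod_apply, localization_cohomologyMap_coindTateDualMor]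
  -- the one-orbit data at `v ∣ p`, pre-elaborated in the `Place.Completion` spelling of the Literature lemma
  have hU' : ∀ d : absoluteGaloisGroup (Place.Completion (Sum.inr v : Place ℚ)),
      d ∈ (layerGroup κ v n : Subgroup (absoluteGaloisGroup (Place.Completion (Sum.inr v : Place ℚ)))) →
        absGaloisRestrict ℚ (Place.Completion (Sum.inr v : Place ℚ)) d ∈ κ.layerSubgroup n := fun _ h => h
  have hbij : Function.Bijective (quotientPull (κ.layerSubgroup n) (absGaloisRestrict ℚ (Place.Completion (Sum.inr v : Place ℚ)))
      (layerGroup κ v n : Subgroup (absoluteGaloisGroup (Place.Completion (Sum.inr v : Place ℚ)))) hU') :=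
    SignedKatoOffTwo.LayerPairing.quotientPull_layerGroup_bijective κ v hκ hv n
  have key := @localTatePairing_coind_cohomologyMap_eq_cupProduct_pull ℚ _ _ _ _ _ _ _ _ _ _
    (W.torsionGaloisModule (N : ℤ)) (W.torsionGaloisModule (N : ℤ)) (κ.layerSubgroup n) _ N
    (weilPairingHom W N e hμ hadd₁ hadd₂) (κ.isOpen_layerSubgroup n)
    (fun σ S T => (weilContPairing W N e hμ hadd₁ hadd₂ hgal).toLin_smul σ S T) _ (Sum.inr v) (layerGroup κ v n)
    hU' (layerFintypeQuot κ v n) hbij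
  rw [key, ← cohomologyMap_coindFinPull_localization_shapiroLift W N κ v hκ hv n hs hs1 b]
  rfl

include hκ hv in
/-- **Both classes global: `⟨loc_v (Sh a), loc_v (H¹(Ψ)(Sh b))⟩_v = CyclotomicLayer.layerPairingMod W N e … κ v n a Q`** whenever the layer
localisation of `b` is the layer Kummer class of `Q ∈ E(ℚ_{n,v})` — the local term at `v ∣ p` of Poitou–Tate for `Maps(Γ_ℚ ⧸ Γ_n, E[N])` and
THE canonical maps, in the currency of the (S_PT) assembly's hypothesis (E) (`B9-INTERFACE-g10.md`). §1 + the previous theorem +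
`layerPairingMod_apply`. [cite: Kobayashi2003, (8.23) (p. 18)] [cite: MilneADT2006, Ch. I §6 (proof of Prop. 6.9)] -/
theorem localTatePairingZMod_canonical_localization_shapiroLift_shapiroLift (n : ℕ)
    [Fintype (absoluteGaloisGroup ℚ ⧸ κ.layerSubgroup n)]
    {s : absoluteGaloisGroup ℚ ⧸ κ.layerSubgroup n → absoluteGaloisGroup ℚ}
    (hs : ∀ y, (s y : absoluteGaloisGroup ℚ ⧸ κ.layerSubgroup n) = y)
    (hs1 : s ((1 : absoluteGaloisGroup ℚ) : absoluteGaloisGroup ℚ ⧸ κ.layerSubgroup n) = 1)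
    (a b : H1 (W.torsionGaloisModule (N : ℤ)) (κ.layerSubgroup n))
    (Q : localLayerPointsOfEmb κ (closureEmb (K := ℚ) (v.adicCompletion ℚ)) W n)
    (hb : layerLoc W N κ v n b = layerKummer W N κ v n Q) :
    localTatePairingZMod ((W.torsionGaloisModule (N : ℤ)).coind (κ.layerSubgroup n) (κ.isOpen_layerSubgroup n)) N (Sum.inr v)
        (LocalInvariants.canonical ℚ N (Sum.inr v))
        (galoisCohomology.localization ((W.torsionGaloisModule (N : ℤ)).coind (κ.layerSubgroup n) (κ.isOpen_layerSubgroup n))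
          (Sum.inr v) 1
          (shapiroLift (W.torsionGaloisModule (N : ℤ)).toTopRep (κ.layerSubgroup n) (κ.isOpen_layerSubgroup n) hs hs1 a))
        (galoisCohomology.localization
          (((W.torsionGaloisModule (N : ℤ)).coind (κ.layerSubgroup n) (κ.isOpen_layerSubgroup n)).tateDual N) (Sum.inr v) 1
          (cohomologyMap (coindTateDualMor (W.torsionGaloisModule (N : ℤ)) (W.torsionGaloisModule (N : ℤ)) (κ.layerSubgroup n)
              (weilPairingHom W N e hμ hadd₁ hadd₂) (κ.isOpen_layerSubgroup n)
              (fun σ S T => (weilContPairing W N e hμ hadd₁ hadd₂ hgal).toLin_smul σ S T)) 1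
            (shapiroLift (W.torsionGaloisModule (N : ℤ)).toTopRep (κ.layerSubgroup n) (κ.isOpen_layerSubgroup n) hs hs1 b))) =
      layerPairingMod W N e hμ hadd₁ hadd₂ hgal κ v n a Q := by
  rw [localTatePairingZMod_canonical_localization_coindTateDual_shapiroLift W N e hμ hadd₁ hadd₂ hgal κ v hκ hv n hs hs1,
    cohomologyMap_coindFinPull_localization_shapiroLift W N κ v hκ hv n hs hs1 a, hb, layerPairingMod_apply]

/-! ## §3 Duality: `H¹(Ψ)`, `pull_v` are bijections; the dual transport; non-degeneracy of the layer pairing -/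

/-- **A bijective morphism of DISCRETE topological representations induces bijections on cohomology** (it is an isomorphism:
the inverse is automatically continuous; `topRepIsoOfEquiv`, `continuousCohomologyEquivOfIso`). [cite: NeukirchSchmidtWingberg2008, I §3] -/
theorem bijective_cohomologyMap_of_bijective {k : Type} [CommRing k] [TopologicalSpace k] {G : Type} [Group G] [TopologicalSpace G]
    [IsTopologicalGroup G] {A B : TopRep.{0} k G} [DiscreteTopology A] [DiscreteTopology B] (f : A ⟶ B)
    (hf : Function.Bijective f.hom) (q : ℕ) : Function.Bijective (cohomologyMap f q) := by
  let e : A ≃L[k] B :=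
    { (LinearEquiv.ofBijective f.hom.toContinuousLinearMap.toLinearMap hf) with
      continuous_toFun := continuous_of_discreteTopology
      continuous_invFun := continuous_of_discreteTopology }
  have he : ∀ (g : G) (x : A), e (A.ρ g x) = B.ρ g (e x) := fun g x => TopRep.hom_comm_apply f g x
  have hhom : (topRepIsoOfEquiv e he).hom = f := rfl
  rw [← hhom]
  exact (continuousCohomologyEquivOfIso (topRepIsoOfEquiv e he) q).bijective

/-- **The Weil dual map `T ↦ e(·, T) : E[N] → E[N]^D` is bijective** for `e` non-degenerate on the right: injective
(`weilDualHom_injective`) between finite sets of the same size (`#Hom(E[N], μ_N) = #E[N]`: `HomCarrier.natCard_eq`, `muEquivZMod`).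
[cite: SilvermanAEC2009, Prop. III.8.1 (c)] [cite: MilneADT2006, Ch. I §0] -/
theorem bijective_weilPairingHom_flip (hnondeg : ∀ T, (∀ S, e S T = 1) → T = 0) :
    Function.Bijective fun T : geomTorsion W N => (weilPairingHom W N e hμ hadd₁ hadd₂).flip T := by
  haveI : Finite (TateDual ℚ (geomTorsion W N) N) := DiscreteGaloisModule.TateDual.finite ℚ (geomTorsion W N) N
  exact (weilDualHom_injective W N e hμ hadd₁ hadd₂ hnondeg).bijective_of_nat_card_le
    (le_of_eq (HomCarrier.natCard_eq (M := geomTorsion W N) (muEquivZMod ℚ N) fun T ↦ AddSubgroup.torsionBy.nsmul T))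

include hκ hv in
omit [W.IsElliptic] [NeZero N] in
/-- **`pull_v = H¹(coindFinPull)` is bijective at `v ∣ p`** (any degree): `φ ↦ φ ∘ θ̄` is a bijection `Maps(Γ_ℚ ⧸ Γ_n, E[N]) → Maps(Γ_v ⧸ U_n, E[N])`
because `θ̄` is (one orbit, K3's `quotientPull_layerGroup_bijective`), between discrete representations.
[cite: NeukirchSchmidtWingberg2008, I §6 (1.6.5)] -/
theorem bijective_cohomologyMap_coindFinPull (n : ℕ) [Fintype (absoluteGaloisGroup ℚ ⧸ κ.layerSubgroup n)] (q : ℕ) :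
    Function.Bijective (cohomologyMap (coindFinPull (W.torsionGaloisModule (N : ℤ)).toTopRep (κ.layerSubgroup n)
        (resGalOfEmb (closureEmb (K := ℚ) (v.adicCompletion ℚ))) (X' := torsionLocalRep W N v)
        (TopRep.ofHom ⟨ContinuousLinearMap.id ℤ (geomTorsion W N), fun _ => rfl⟩) (layerGroup κ v n) (fun _ h => h)) q) := by
  letI : Fintype (absoluteGaloisGroup (v.adicCompletion ℚ) ⧸ layerGroup κ v n) := layerFintypeQuot κ v n
  haveI : DiscreteTopology (TopRep.res (resGalOfEmb (closureEmb (K := ℚ) (v.adicCompletion ℚ)) :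
      absoluteGaloisGroup (v.adicCompletion ℚ) →* absoluteGaloisGroup ℚ)
        (coindFin.{0, 0} (W.torsionGaloisModule (N : ℤ)).toTopRep (κ.layerSubgroup n))) :=
    inferInstanceAs (DiscreteTopology (absoluteGaloisGroup ℚ ⧸ κ.layerSubgroup n → geomTorsion W N))
  haveI : DiscreteTopology (coindFin.{0, 0} (torsionLocalRep W N v) (layerGroup κ v n)) :=
    inferInstanceAs (DiscreteTopology (absoluteGaloisGroup (v.adicCompletion ℚ) ⧸ layerGroup κ v n → geomTorsion W N))
  refine bijective_cohomologyMap_of_bijective _ ?_ q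
  set θbar := quotientPull (κ.layerSubgroup n) (resGalOfEmb (closureEmb (K := ℚ) (v.adicCompletion ℚ))) (layerGroup κ v n)
    (fun _ h => h)
  have hbij : Function.Bijective θbar := SignedKatoOffTwo.LayerPairing.quotientPull_layerGroup_bijective κ v hκ hv n
  refine ⟨fun φ ψ h => ?_, fun g => ?_⟩
  · funext y
    obtain ⟨z, rfl⟩ := hbij.2 y
    exact congrFun h z
  · refine ⟨fun y => g ((Equiv.ofBijective θbar hbij).symm y), funext fun z => ?_⟩
    change g ((Equiv.ofBijective θbar hbij).symm (θbar z)) = g z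
    rw [← Equiv.ofBijective_apply θbar hbij z, Equiv.symm_apply_apply]

/-- **Every class of `H¹(ℚ, Maps(Γ_ℚ ⧸ Γ_n, E[N])^D)` is `H¹(Ψ)(Sh b)` for a UNIQUE layer class `b ∈ H¹(Γ_n, E[N])`** (Shapiro + the Weil
self-duality; `exists_unique_shapiroLift_coindTateDualMor_eq` with `bijective_weilPairingHom_flip`) — the dictionary by which w2's transfer
brick B5 reads dual-side Selmer classes `y ∈ H¹_{𝓕*}(ℚ, ρc^D)` as layer classes. [cite: NeukirchSchmidtWingberg2008, I §6 Prop. (1.6.4)]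
[cite: MilneADT2006, Ch. I Cor. 2.3] -/
theorem existsUnique_shapiroLift_coindTateDual_eq (hnondeg : ∀ T, (∀ S, e S T = 1) → T = 0) (n : ℕ)
    [Fintype (absoluteGaloisGroup ℚ ⧸ κ.layerSubgroup n)]
    {s : absoluteGaloisGroup ℚ ⧸ κ.layerSubgroup n → absoluteGaloisGroup ℚ}
    (hs : ∀ y, (s y : absoluteGaloisGroup ℚ ⧸ κ.layerSubgroup n) = y)
    (hs1 : s ((1 : absoluteGaloisGroup ℚ) : absoluteGaloisGroup ℚ ⧸ κ.layerSubgroup n) = 1)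
    (y : galoisCohomology (((W.torsionGaloisModule (N : ℤ)).coind (κ.layerSubgroup n) (κ.isOpen_layerSubgroup n)).tateDual N) 1) :
    ∃! b : H1 (W.torsionGaloisModule (N : ℤ)) (κ.layerSubgroup n),
      cohomologyMap (coindTateDualMor (W.torsionGaloisModule (N : ℤ)) (W.torsionGaloisModule (N : ℤ)) (κ.layerSubgroup n)
          (weilPairingHom W N e hμ hadd₁ hadd₂) (κ.isOpen_layerSubgroup n)
          (fun σ S T => (weilContPairing W N e hμ hadd₁ hadd₂ hgal).toLin_smul σ S T)) 1
        (shapiroLift (W.torsionGaloisModule (N : ℤ)).toTopRep (κ.layerSubgroup n) (κ.isOpen_layerSubgroup n) hs hs1 b) = y :=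
  exists_unique_shapiroLift_coindTateDualMor_eq _ _ _ _ _ _ (bijective_weilPairingHom_flip W N e hμ hadd₁ hadd₂ hnondeg) hs hs1 y

include hκ hv in
/-- **The dual transport `T_v : H¹(Γ_v, Maps(Γ_v ⧸ U_n, E[N]|)) ↪ H¹(ℚ_v, Maps(Γ_ℚ ⧸ Γ_n, E[N])^D)`** (existence, injective, additive):
for every local layer-model class `t` there is a dual class `T_v t` whose local Tate pairing character (THE canonical maps) is
`a' ↦ invAt_v (pull_v a' ∪_{layerSumPairing} t)`.  (`T_v = H¹(Ψ|_{Γ_v}) ∘ pull_v⁻¹`: `pull_v` bijective at `v ∣ p`, `Ψ` an isomorphism for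
`e` non-degenerate; value by `localTatePairing_coind_cohomologyMap_eq_cupProduct_pull`.)  With `t = layerShapiro (layerKummer Q)`,
`Q ∈ E^ε(ℚ_{n,v})`, these are the classes `c_Q` of the subgroup `C` fed to `SelmerComplement.exists_selmer_localTatePairing_eq_of_subgroup`
(design memo §2 (a)). [cite: MilneADT2006, Ch. I Cor. 2.3, Ch. I §6 (proof of Prop. 6.9)] [cite: Kobayashi2003, (8.23) (p. 18)] -/
theorem exists_injective_dualTransport (hnondeg : ∀ T, (∀ S, e S T = 1) → T = 0) (n : ℕ)
    [Fintype (absoluteGaloisGroup ℚ ⧸ κ.layerSubgroup n)] :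
    ∃ T : continuousCohomology.{0, 0, 0} 1 (coindFin.{0, 0} (torsionLocalRep W N v) (layerGroup κ v n)) →+
        galoisCohomology ((((W.torsionGaloisModule (N : ℤ)).coind (κ.layerSubgroup n) (κ.isOpen_layerSubgroup n)).tateDual N).toLocal
          (Sum.inr v)) 1,
      Function.Injective T ∧
      ∀ (t : continuousCohomology.{0, 0, 0} 1 (coindFin.{0, 0} (torsionLocalRep W N v) (layerGroup κ v n)))
        (a' : galoisCohomology
          (((W.torsionGaloisModule (N : ℤ)).coind (κ.layerSubgroup n) (κ.isOpen_layerSubgroup n)).toLocal (Sum.inr v)) 1),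
        localTatePairingZMod ((W.torsionGaloisModule (N : ℤ)).coind (κ.layerSubgroup n) (κ.isOpen_layerSubgroup n)) N (Sum.inr v)
            (LocalInvariants.canonical ℚ N (Sum.inr v)) a' (T t) =
          invAt N v ((layerSumPairing W N e hμ hadd₁ hadd₂ hgal κ v n).cupProduct
            (cohomologyMap (coindFinPull (W.torsionGaloisModule (N : ℤ)).toTopRep (κ.layerSubgroup n)
              (resGalOfEmb (closureEmb (K := ℚ) (v.adicCompletion ℚ))) (X' := torsionLocalRep W N v)
              (TopRep.ofHom ⟨ContinuousLinearMap.id ℤ (geomTorsion W N), fun _ => rfl⟩) (layerGroup κ v n) (fun _ h => h)) 1 a')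
            t) := by
  -- `Ψ|_{Γ_v}` in the spelling of the Literature lemma, and the pull equivalence
  let Ψv : TopRep.res (absGaloisRestrict ℚ (Place.Completion (Sum.inr v : Place ℚ)) :
      absoluteGaloisGroup (Place.Completion (Sum.inr v : Place ℚ)) →* absoluteGaloisGroup ℚ)
        (coindFin.{0, 0} (W.torsionGaloisModule (N : ℤ)).toTopRep (κ.layerSubgroup n)) ⟶
      ((((W.torsionGaloisModule (N : ℤ)).coind (κ.layerSubgroup n) (κ.isOpen_layerSubgroup n)).tateDual N).toLocal
        (Sum.inr v)).toTopRep :=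
    TopRep.ofHom ⟨(coindTateDualMor (W.torsionGaloisModule (N : ℤ)) (W.torsionGaloisModule (N : ℤ)) (κ.layerSubgroup n)
        (weilPairingHom W N e hμ hadd₁ hadd₂) (κ.isOpen_layerSubgroup n)
        (fun σ S T => (weilContPairing W N e hμ hadd₁ hadd₂ hgal).toLin_smul σ S T)).hom.toContinuousLinearMap, fun d =>
      (coindTateDualMor (W.torsionGaloisModule (N : ℤ)) (W.torsionGaloisModule (N : ℤ)) (κ.layerSubgroup n)
        (weilPairingHom W N e hμ hadd₁ hadd₂) (κ.isOpen_layerSubgroup n)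
        (fun σ S T => (weilContPairing W N e hμ hadd₁ hadd₂ hgal).toLin_smul σ S T)).hom.isIntertwining'
          (absGaloisRestrict ℚ (Place.Completion (Sum.inr v : Place ℚ)) d)⟩
  have hΨv : Function.Injective (cohomologyMap Ψv 1) := by
    haveI : DiscreteTopology (TopRep.res (absGaloisRestrict ℚ (Place.Completion (Sum.inr v : Place ℚ)) :
        absoluteGaloisGroup (Place.Completion (Sum.inr v : Place ℚ)) →* absoluteGaloisGroup ℚ)
          (coindFin.{0, 0} (W.torsionGaloisModule (N : ℤ)).toTopRep (κ.layerSubgroup n))) :=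
      inferInstanceAs (DiscreteTopology (absoluteGaloisGroup ℚ ⧸ κ.layerSubgroup n → geomTorsion W N))
    haveI : DiscreteTopology ((((W.torsionGaloisModule (N : ℤ)).coind (κ.layerSubgroup n) (κ.isOpen_layerSubgroup n)).tateDual N).toLocal
        (Sum.inr v)).toTopRep :=
      inferInstanceAs (DiscreteTopology (TateDual ℚ (absoluteGaloisGroup ℚ ⧸ κ.layerSubgroup n → geomTorsion W N) N))
    refine (bijective_cohomologyMap_of_bijective Ψv ?_ 1).1
    exact coindTateDualHom_bijective (κ.layerSubgroup n) (weilPairingHom W N e hμ hadd₁ hadd₂)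
      (bijective_weilPairingHom_flip W N e hμ hadd₁ hadd₂ hnondeg)
  let PM := coindFinPull (W.torsionGaloisModule (N : ℤ)).toTopRep (κ.layerSubgroup n)
    (resGalOfEmb (closureEmb (K := ℚ) (v.adicCompletion ℚ))) (X' := torsionLocalRep W N v)
    (TopRep.ofHom ⟨ContinuousLinearMap.id ℤ (geomTorsion W N), fun _ => rfl⟩) (layerGroup κ v n) (fun _ h => h)
  have hpull : Function.Bijective ((cohomologyMap PM 1).hom.toLinearMap.toAddMonoidHom) :=
    bijective_cohomologyMap_coindFinPull W N κ v hκ hv n 1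
  let Epull := AddEquiv.ofBijective _ hpull
  refine ⟨(cohomologyMap Ψv 1).hom.toLinearMap.toAddMonoidHom.comp Epull.symm.toAddMonoidHom,
    hΨv.comp Epull.symm.injective, fun t a' => ?_⟩
  obtain ⟨t', rfl⟩ := hpull.2 t
  have hsymm : Epull.symm ((cohomologyMap PM 1).hom.toLinearMap.toAddMonoidHom t') = t' := Epull.symm_apply_apply t'
  -- the one-orbit data at `v ∣ p`, pre-elaborated in the `Place.Completion` spelling of the Literature lemma
  have hU' : ∀ d : absoluteGaloisGroup (Place.Completion (Sum.inr v : Place ℚ)),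
      d ∈ (layerGroup κ v n : Subgroup (absoluteGaloisGroup (Place.Completion (Sum.inr v : Place ℚ)))) →
        absGaloisRestrict ℚ (Place.Completion (Sum.inr v : Place ℚ)) d ∈ κ.layerSubgroup n := fun _ h => h
  have hbij : Function.Bijective (quotientPull (κ.layerSubgroup n) (absGaloisRestrict ℚ (Place.Completion (Sum.inr v : Place ℚ)))
      (layerGroup κ v n : Subgroup (absoluteGaloisGroup (Place.Completion (Sum.inr v : Place ℚ)))) hU') :=
    SignedKatoOffTwo.LayerPairing.quotientPull_layerGroup_bijective κ v hκ hv n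
  have key := @localTatePairing_coind_cohomologyMap_eq_cupProduct_pull ℚ _ _ _ _ _ _ _ _ _ _
    (W.torsionGaloisModule (N : ℤ)) (W.torsionGaloisModule (N : ℤ)) (κ.layerSubgroup n) _ N
    (weilPairingHom W N e hμ hadd₁ hadd₂) (κ.isOpen_layerSubgroup n)
    (fun σ S T => (weilContPairing W N e hμ hadd₁ hadd₂ hgal).toLin_smul σ S T) _ (Sum.inr v) (layerGroup κ v n)
    hU' (layerFintypeQuot κ v n) hbij a' t'
  rw [localTatePairingZMod_apply]
  exact (congrArg (fun x => LocalInvariants.canonical ℚ N (Sum.inr v) (localTatePairing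
      ((W.torsionGaloisModule (N : ℤ)).coind (κ.layerSubgroup n) (κ.isOpen_layerSubgroup n)) N (Sum.inr v) a'
        (cohomologyMap Ψv 1 x))) hsymm).trans
    (congrArg (LocalInvariants.canonical ℚ N (Sum.inr v)) key)

include hκ hv in
/-- **Non-degeneracy of the layer pairing (local Tate duality for `ℚ_{n,v}` in the Shapiro model)**: a class
`t ∈ H¹(Γ_v, Maps(Γ_v ⧸ U_n, E[N]|))` with `invAt_v (pull_v a' ∪_{layerSumPairing} t) = 0` for every `a' ∈ H¹(ℚ_v, Maps(Γ_ℚ ⧸ Γ_n, E[N]))` is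
`0` — from `IsPerfect` of THE canonical family on `Maps(Γ_ℚ ⧸ Γ_n, E[N])` (`LocalInvariants.canonical_isPerfect`) through the dual transport.
This is what makes `Q ↦ c_Q` injective modulo `N·E(ℚ_{n,v})` (the character `χ_z` of design memo §2 (a) is well defined on `C`).
[cite: MilneADT2006, Ch. I Cor. 2.3] [cite: Kobayashi2003, (8.23) (p. 18)] -/
theorem eq_zero_of_forall_invAt_cupProduct_pull_eq_zero (hnondeg : ∀ T, (∀ S, e S T = 1) → T = 0) (n : ℕ)
    [Fintype (absoluteGaloisGroup ℚ ⧸ κ.layerSubgroup n)]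
    (t : continuousCohomology.{0, 0, 0} 1 (coindFin.{0, 0} (torsionLocalRep W N v) (layerGroup κ v n)))
    (ht : ∀ a' : galoisCohomology
        (((W.torsionGaloisModule (N : ℤ)).coind (κ.layerSubgroup n) (κ.isOpen_layerSubgroup n)).toLocal (Sum.inr v)) 1,
      invAt N v ((layerSumPairing W N e hμ hadd₁ hadd₂ hgal κ v n).cupProduct
        (cohomologyMap (coindFinPull (W.torsionGaloisModule (N : ℤ)).toTopRep (κ.layerSubgroup n)
          (resGalOfEmb (closureEmb (K := ℚ) (v.adicCompletion ℚ))) (X' := torsionLocalRep W N v)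
          (TopRep.ofHom ⟨ContinuousLinearMap.id ℤ (geomTorsion W N), fun _ => rfl⟩) (layerGroup κ v n) (fun _ h => h)) 1 a')
        t) = 0) :
    t = 0 := by
  obtain ⟨T, hT, hTpair⟩ := exists_injective_dualTransport W N e hμ hadd₁ hadd₂ hgal κ v hκ hv hnondeg n
  have hM : ∀ m : absoluteGaloisGroup ℚ ⧸ κ.layerSubgroup n → geomTorsion W N, N • m = 0 := fun φ =>
    funext fun y => AddSubgroup.torsionBy.nsmul (φ y)
  have hperf := (LocalInvariants.canonical_isPerfect (K := ℚ) (n := N) v).2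
    ((W.torsionGaloisModule (N : ℤ)).coind (κ.layerSubgroup n) (κ.isOpen_layerSubgroup n)) hM
  have h0 : T t = 0 := by
    apply hperf.2.1
    ext a'
    rw [AddMonoidHom.flip_apply, AddMonoidHom.flip_apply, hTpair, ht, map_zero]
  exact hT (by rw [h0, map_zero])

end SignedLowerOffTwo.PTDeep

end Summit.BirchSwinnertonDyer.BirchSwinnertonDyer.Theorems

end
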